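import Literature.Probability.Percolation.SlabRSWGluingLinear
import HarnessLib

/-!
# Newman–Tassion–Wu 2017, §3.2 — GL0 (linear regime) for crossings of a rectangle

Topic: `Literature/Probability/Percolation`. Seventh file of the port of §3 of Newman–Tassion–Wu,
*Critical percolation and the minimal spanning tree in slabs* (CPAM 70 (2017); arXiv:1512.09107).
`SlabRSWGluingLinear.lean` proves GL0 (Thm. 3.6, `h₀` linear) under NTW's planar-crossing
hypothesis `PlanarCrossing S A B C D` ("the projection of any path from `A` to `B` in `S`
intersects the projection of any path from `C` to `D`"). Here that hypothesis is DISCHARGED in the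
geometry of all its uses in §3: `A` on the left side and `B` the right side of the rectangle, `C`
and `D` on the bottom and top sides (either way round) — by the tree's discrete Jordan-curve fact
`exists_mem_support_of_crossing` (`PlanarDuality.lean`: a left-right and a top-bottom lattice walk
of a rectangle meet).

* `exists_walk_of_planarWalk` — a planar walk (consecutive cells equal or adjacent) shadows a
  lattice walk of `ℤ²` through the same cells.
* `planarCrossing_rect` — PROVED: `PlanarCrossing S A B C D` for `A ⊆` left side, `B ⊆` right side,
  `C ⊆` bottom, `D ⊆` top (and `planarCrossing_rect'` with `C ⊆` top, `D ⊆` bottom).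
* `glueLinear_rect` — PROVED: **GL0, linear regime, for a rectangle of the slab `S_k`**: with
  `S = [a,b] × [c,d]`, `B = {b} × [c,d]`, `A ⊆ {a} × [c,d]`, `C` on the bottom side and `D` on the
  top side (or vice versa), `dist*(A, C) > 4ρ + 8`:
  `P_p[A ⟷^S B] · P_p[C ⟷^S D] ≤ (1 + λ^s) · P_p[C ⟷^S A]`.

## Sources

* C. M. Newman, V. Tassion, W. Wu, *Critical percolation and the minimal spanning tree in slabs*,
  Comm. Pure Appl. Math. 70 (2017), arXiv:1512.09107: §3.2, Theorem 3.6 and its proof (p. 10);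
  §3.3–3.5 (its uses with sides of rectangles) [NewmanTassionWu2017].
-/

noncomputable section

namespace Literature.Probability.Percolation

open MeasureTheory LatticeModels SimpleGraph

namespace NTW17

variable {k : ℕ}

/-! ## Planar walks shadow lattice walks -/

/-- **A planar walk shadows a lattice walk of `ℤ²`** through the same cells (repeated cells are
dropped). [cite: NewmanTassionWu2017, §3.2 (Theorem 3.6, "the projection on ℤ² of any path")] -/
theorem exists_walk_of_planarWalk :
    ∀ (a : ℤ × ℤ) (l : List (ℤ × ℤ)), IsPlanarWalk (a :: l) →
      ∃ (e : ℤ × ℤ) (W : (zdGraph 2).Walk (ts a) (ts e)),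
        (a :: l).getLast (List.cons_ne_nil a l) = e ∧ ∀ x ∈ W.support, ∃ v ∈ a :: l, ts v = x := by
  intro a l
  induction l generalizing a with
  | nil =>
    intro _
    refine ⟨a, Walk.nil, rfl, fun x hx => ⟨a, by simp, ?_⟩⟩
    rw [Walk.support_nil, List.mem_singleton] at hx
    exact hx.symm
  | cons b l ih =>
    intro hc
    rw [IsPlanarWalk, List.isChain_cons_cons] at hc
    obtain ⟨e, W, he, hW⟩ := ih b hc.2
    have hlast : (a :: b :: l).getLast (List.cons_ne_nil a (b :: l)) = e := by
      rw [List.getLast_cons (List.cons_ne_nil b l)]; exact he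
    rcases hc.1 with hab | hab
    · subst hab
      refine ⟨e, W, hlast, fun x hx => ?_⟩
      obtain ⟨v, hv, rfl⟩ := hW x hx
      exact ⟨v, by simp [hv], rfl⟩
    · refine ⟨e, Walk.cons (adj_ts_of_planarAdj hab) W, hlast, fun x hx => ?_⟩
      rw [Walk.support_cons, List.mem_cons] at hx
      rcases hx with rfl | hx
      · exact ⟨a, by simp, rfl⟩
      · obtain ⟨v, hv, rfl⟩ := hW x hx
        exact ⟨v, by simp [hv], rfl⟩

/-! ## The planar-crossing hypothesis for sides of a rectangle -/

/-- **Left-right against bottom-top.** In the rectangle `[a,b] × [c,d]`, every planar walk from the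
left side to the right side meets every planar walk from the bottom side to the top side.
[cite: NewmanTassionWu2017, §3.2 (Theorem 3.6, the hypothesis in its uses of §§3.3–3.5)] -/
theorem planarCrossing_rect {a b c d : ℤ} {A B C D : Set (ℤ × ℤ)}
    (hA : ∀ z ∈ A, z.1 = a) (hB : ∀ z ∈ B, z.1 = b) (hC : ∀ z ∈ C, z.2 = c) (hD : ∀ z ∈ D, z.2 = d) :
    PlanarCrossing (boxR a b c d) A B C D := by
  intro l₁ l₂ h₁ h₂ hw₁ hw₂ hS₁ hS₂ hhA hlB hhC hlD
  obtain ⟨x₁, r₁, rfl⟩ := List.exists_cons_of_ne_nil h₁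
  obtain ⟨x₂, r₂, rfl⟩ := List.exists_cons_of_ne_nil h₂
  obtain ⟨e₁, W₁, he₁, hW₁⟩ := exists_walk_of_planarWalk x₁ r₁ hw₁
  obtain ⟨e₂, W₂, he₂, hW₂⟩ := exists_walk_of_planarWalk x₂ r₂ hw₂
  have hbox : ∀ (l : List (ℤ × ℤ)), (∀ z ∈ l, z ∈ boxR a b c d) →
      ∀ {u v : Site 2} (W : (zdGraph 2).Walk u v), (∀ x ∈ W.support, ∃ w ∈ l, ts w = x) →
      ∀ x ∈ W.support, a ≤ x 0 ∧ x 0 ≤ b ∧ c ≤ x 1 ∧ x 1 ≤ d := by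
    intro l hl u v W hW x hx
    obtain ⟨w, hw, rfl⟩ := hW x hx
    have := hl w hw
    rw [mem_boxR_iff] at this
    simpa using this
  have he₁B : e₁ ∈ B := by rw [← he₁]; exact hlB
  have he₂D : e₂ ∈ D := by rw [← he₂]; exact hlD
  obtain ⟨z, hz₁, hz₂⟩ := exists_mem_support_of_crossing W₁ W₂ (hbox _ hS₁ W₁ hW₁) (hbox _ hS₂ W₂ hW₂)
    (by simpa using hA x₁ hhA) (by simpa using hB e₁ he₁B) (by simpa using hC x₂ hhC)
    (by simpa using hD e₂ he₂D)
  obtain ⟨v₁, hv₁, rfl⟩ := hW₁ z hz₁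
  obtain ⟨v₂, hv₂, hv⟩ := hW₂ _ hz₂
  exact ⟨v₁, hv₁, by rwa [← ts_injective hv]⟩

/-- **Left-right against top-bottom.** The same with `C` on the top side and `D` on the bottom
side. [cite: NewmanTassionWu2017, §3.2 (Theorem 3.6, the hypothesis in its uses of §§3.3–3.5)] -/
theorem planarCrossing_rect' {a b c d : ℤ} {A B C D : Set (ℤ × ℤ)}
    (hA : ∀ z ∈ A, z.1 = a) (hB : ∀ z ∈ B, z.1 = b) (hC : ∀ z ∈ C, z.2 = d) (hD : ∀ z ∈ D, z.2 = c) :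
    PlanarCrossing (boxR a b c d) A B C D := by
  intro l₁ l₂ h₁ h₂ hw₁ hw₂ hS₁ hS₂ hhA hlB hhC hlD
  -- reverse the second walk
  have hw₂' : IsPlanarWalk l₂.reverse := by
    rw [IsPlanarWalk, List.isChain_reverse]
    refine hw₂.imp fun x y h => ?_
    rcases h with h | h
    · exact Or.inl h.symm
    · exact Or.inr (planarAdj_symm h)
  have h₂' : l₂.reverse ≠ [] := by simpa using h₂
  obtain ⟨z, hz₁, hz₂⟩ := planarCrossing_rect hA hB hD hC l₁ l₂.reverse h₁ h₂' hw₁ hw₂' hS₁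
    (fun z hz => hS₂ z (List.mem_reverse.1 hz)) hhA hlB
    (by rw [List.head_reverse]; exact hlD) (by rw [List.getLast_reverse]; exact hhC)
  exact ⟨z, hz₁, List.mem_reverse.1 hz₂⟩

/-! ## GL0, linear regime, for crossings of a rectangle -/

/-- **NTW 2017, Theorem 3.6 (GL0), linear regime, for a rectangle of the slab** — the form used
throughout §§3.3–3.5: `S = [a,b] × [c,d]` (at least four columns and rows) in `S_k`, `k ≥ 1`; `B`
the right side `{b} × [c,d]`, `A` a subset of the left side, `C` a subset of the bottom side and
`D` of the top side, with `dist*(A, C) > 4ρ + 8` for some `ρ ≥ 2`; then for `0 < p < 1`,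
`P_p[A ⟷^S B] · P_p[C ⟷^S D] ≤ (1 + λ^s) · P_p[C ⟷^S A]`, `λ = 2/min{p,1-p}`,
`s = 3(5k+4)(12ρ+9)²`. [cite: NewmanTassionWu2017, §3.2 (Theorem 3.6 with Remark 3: h₀(x) ≥ c₀ x)] -/
theorem glueLinear_rect (T : RectSetup) (hk : 1 ≤ k) {ρ : ℕ} (hρ : 2 ≤ ρ)
    (hsep : ∀ a' ∈ T.A, ∀ c' ∈ T.C, c' ∉ sqBox a' (4 * ρ + 8))
    (hAl : ∀ z ∈ T.A, z.1 = T.a) (hCb : ∀ z ∈ T.C, z.2 = T.c) {Dd : Set (ℤ × ℤ)}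
    (hDt : ∀ z ∈ Dd, z.2 = T.d) (p : unitInterval) (hp0 : 0 < (p : ℝ)) (hp1 : (p : ℝ) < 1) :
    (bondPercolation (slabGraph 3 k) p).real (slabConn k T.S T.A T.B) *
        (bondPercolation (slabGraph 3 k) p).real (slabConn k T.S T.C Dd) ≤
      (1 + (2 / min (p : ℝ) (1 - p)) ^ (3 * ((5 * k + 4) * (2 * (6 * ρ + 4) + 1) ^ 2))) *
        (bondPercolation (slabGraph 3 k) p).real (slabConn k T.S T.C T.A) :=
  glueLinear T hk hρ hsep (planarCrossing_rect (a := T.a) (b := T.b) (c := T.c) (d := T.d)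
    hAl (fun _ hz => hz.2) hCb hDt) p hp0 hp1

/-- The same with `C` on the top side and `D` on the bottom side.
[cite: NewmanTassionWu2017, §3.2 (Theorem 3.6 with Remark 3: h₀(x) ≥ c₀ x)] -/
theorem glueLinear_rect' (T : RectSetup) (hk : 1 ≤ k) {ρ : ℕ} (hρ : 2 ≤ ρ)
    (hsep : ∀ a' ∈ T.A, ∀ c' ∈ T.C, c' ∉ sqBox a' (4 * ρ + 8))
    (hAl : ∀ z ∈ T.A, z.1 = T.a) (hCt : ∀ z ∈ T.C, z.2 = T.d) {Dd : Set (ℤ × ℤ)}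
    (hDb : ∀ z ∈ Dd, z.2 = T.c) (p : unitInterval) (hp0 : 0 < (p : ℝ)) (hp1 : (p : ℝ) < 1) :
    (bondPercolation (slabGraph 3 k) p).real (slabConn k T.S T.A T.B) *
        (bondPercolation (slabGraph 3 k) p).real (slabConn k T.S T.C Dd) ≤
      (1 + (2 / min (p : ℝ) (1 - p)) ^ (3 * ((5 * k + 4) * (2 * (6 * ρ + 4) + 1) ^ 2))) *
        (bondPercolation (slabGraph 3 k) p).real (slabConn k T.S T.C T.A) :=
  glueLinear T hk hρ hsep (planarCrossing_rect' (a := T.a) (b := T.b) (c := T.c) (d := T.d)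
    hAl (fun _ hz => hz.2) hCt hDb) p hp0 hp1

end NTW17

end Literature.Probability.Percolation
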